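import Summits.Ventures.PercRepro.RankLevelSetDepCountHeavyCap

/-!
# PercRepro — THE WINDOWED HEAVY COUNT (p8 g5, S3)

`proofs/SUBCLAIM-S3-p8.md` §3r. The size-capped heavy count `ncard_heavy_le_cap` (RankLevelSetDepCountHeavyCap) bounds
the heavy rank-`q` sets of at most `c` elements by `Σ_{j ≤ c} C(|UG|, j) + (n + 1)·Σ_{j ≤ c} C(|UH|, j)`. Two
observations with NO new matroid input sharpen it: a rank-`q` set has at least `q` elements, and a heavy `B ⊆ insert x UH`
either lies in `UH` itself or contains `x ∉ UH`, in which case `B ∖ {x} ⊆ UH` has `|B| − 1 ∈ [q − 1, c − 1]` elements. So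

  `#{heavy, |B| ≤ c} ≤ Σ_{q ≤ j ≤ c} C(|UG|, j) + Σ_{q ≤ j ≤ c} C(|UH|, j) + n·Σ_{q − 1 ≤ j ≤ c − 1} C(|UH|, j)`

(`ncard_heavy_le_cap_window`). At the cell `(30, 8)` of the `q = 6` window (`|UH| ≤ 14`, `c = 8`, `n = 38`) the heavy term
drops from `503 k` to `330 k`, `2.3 %` of the cell. Axioms: standard.
-/

open scoped Matroid

namespace PercRepro

/-- The subsets of a finset `E` with `lo ≤ |X| ≤ k` elements number at most `Σ_{lo ≤ j ≤ k} C(|E|, j)`. -/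
theorem ncard_subsets_ncard_window {α : Type} (E : Finset α) (lo k : ℕ) :
    {X : Set α | X ⊆ (E : Set α) ∧ lo ≤ X.ncard ∧ X.ncard ≤ k}.ncard ≤
      ∑ j ∈ Finset.Icc lo k, E.card.choose j := by
  classical
  set T := (Finset.Icc lo k).biUnion (fun j => E.powersetCard j) with hT
  have hsub : {X : Set α | X ⊆ (E : Set α) ∧ lo ≤ X.ncard ∧ X.ncard ≤ k} ⊆
      ((T.image (fun s : Finset α => (s : Set α)) : Finset (Set α)) : Set (Set α)) := by
    intro X hX
    obtain ⟨hXE, hlo, hk⟩ := hX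
    have hXfin : X.Finite := E.finite_toSet.subset hXE
    refine Finset.mem_coe.2 (Finset.mem_image.2 ⟨hXfin.toFinset, ?_, hXfin.coe_toFinset⟩)
    rw [hT, Finset.mem_biUnion]
    refine ⟨X.ncard, Finset.mem_Icc.2 ⟨hlo, hk⟩, ?_⟩
    rw [Finset.mem_powersetCard]
    refine ⟨?_, ?_⟩
    · intro y hy
      exact Finset.mem_coe.1 (hXE (hXfin.mem_toFinset.1 hy))
    · rw [Set.ncard_eq_toFinset_card X hXfin]
  calc {X : Set α | X ⊆ (E : Set α) ∧ lo ≤ X.ncard ∧ X.ncard ≤ k}.ncard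
      ≤ ((T.image (fun s : Finset α => (s : Set α)) : Finset (Set α)) : Set (Set α)).ncard :=
        Set.ncard_le_ncard hsub (Finset.finite_toSet _)
    _ = (T.image (fun s : Finset α => (s : Set α))).card := Set.ncard_coe_finset _
    _ ≤ T.card := Finset.card_image_le
    _ ≤ ∑ j ∈ Finset.Icc lo k, (E.powersetCard j).card := Finset.card_biUnion_le
    _ = ∑ j ∈ Finset.Icc lo k, E.card.choose j := by
        simp only [Finset.card_powersetCard]

namespace Matroid

open Set Finset

variable {α : Type} {M : _root_.Matroid α}

/-- **THE WINDOWED HEAVY COUNT**: the heavy rank-`q` sets with at most `c` elements number at most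
`Σ_{q ≤ j ≤ c} C(|UG|, j) + Σ_{q ≤ j ≤ c} C(|UH|, j) + n·Σ_{q − 1 ≤ j ≤ c − 1} C(|UH|, j)`. -/
theorem ncard_heavy_le_cap_window [M.Finite] (q ν₁ c : ℕ) :
    {B : Set α | B ⊆ M.E ∧ M.eRk B = (q : ℕ∞) ∧ q + ν₁ ≤ (M.closure B).ncard ∧ B.ncard ≤ c}.ncard ≤
      ∑ j ∈ Finset.Icc q c, (UG M q ν₁).ncard.choose j +
        (∑ j ∈ Finset.Icc q c, (UH M q ν₁).ncard.choose j +
          M.E.ncard * ∑ j ∈ Finset.Icc (q - 1) (c - 1), (UH M q ν₁).ncard.choose j) := by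
  classical
  have hUGE := UG_subset_ground (M := M) q ν₁
  have hUHE := UH_subset_ground (M := M) q ν₁
  have hUGfin : (UG M q ν₁).Finite := M.ground_finite.subset hUGE
  have hUHfin : (UH M q ν₁).Finite := M.ground_finite.subset hUHE
  -- a rank-`q` set has at least `q` elements
  have hq_le : ∀ B ⊆ M.E, M.eRk B = (q : ℕ∞) → q ≤ B.ncard := by
    intro B hB hr
    have h1 := M.eRk_le_encard B
    rw [hr] at h1
    have hBfin : B.Finite := M.ground_finite.subset hB
    rw [← hBfin.cast_ncard_eq] at h1
    exact_mod_cast h1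
  set T₁ := {B : Set α | B ⊆ (hUGfin.toFinset : Set α) ∧ q ≤ B.ncard ∧ B.ncard ≤ c} with hT₁def
  set T₂ := {B : Set α | B ⊆ (hUHfin.toFinset : Set α) ∧ q ≤ B.ncard ∧ B.ncard ≤ c} with hT₂def
  set T₃ := {B : Set α | B ⊆ M.E ∧ ¬ B ⊆ UH M q ν₁ ∧ (∃ x ∈ M.E, B ⊆ insert x (UH M q ν₁)) ∧
    q ≤ B.ncard ∧ B.ncard ≤ c} with hT₃def
  have hsub : {B : Set α | B ⊆ M.E ∧ M.eRk B = (q : ℕ∞) ∧ q + ν₁ ≤ (M.closure B).ncard ∧ B.ncard ≤ c} ⊆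
      T₁ ∪ (T₂ ∪ T₃) := by
    intro B hB
    have hqB : q ≤ B.ncard := hq_le B hB.1 hB.2.1
    rcases heavy_subset hB.1 hB.2.1 hB.2.2.1 with h | h
    · left
      refine ⟨?_, hqB, hB.2.2.2⟩
      rw [Set.Finite.coe_toFinset]
      exact h
    · right
      by_cases hBU : B ⊆ UH M q ν₁
      · left
        refine ⟨?_, hqB, hB.2.2.2⟩
        rw [Set.Finite.coe_toFinset]
        exact hBU
      · exact Or.inr ⟨hB.1, hBU, h, hqB, hB.2.2.2⟩
  have hT₁fin : T₁.Finite := (Finset.finite_toSet _).finite_subsets.subset (fun B hB => hB.1)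
  have hT₂fin : T₂.Finite := (Finset.finite_toSet _).finite_subsets.subset (fun B hB => hB.1)
  have hT₃fin : T₃.Finite := M.ground_finite.finite_subsets.subset (fun B hB => hB.1)
  have hT₁ : T₁.ncard ≤ ∑ j ∈ Finset.Icc q c, (UG M q ν₁).ncard.choose j := by
    have := ncard_subsets_ncard_window hUGfin.toFinset q c
    rwa [← Set.ncard_eq_toFinset_card _ hUGfin] at this
  have hT₂ : T₂.ncard ≤ ∑ j ∈ Finset.Icc q c, (UH M q ν₁).ncard.choose j := by
    have := ncard_subsets_ncard_window hUHfin.toFinset q c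
    rwa [← Set.ncard_eq_toFinset_card _ hUHfin] at this
  have hT₃ : T₃.ncard ≤ M.E.ncard * ∑ j ∈ Finset.Icc (q - 1) (c - 1), (UH M q ν₁).ncard.choose j := by
    have hfin : ({X : Set α | X ⊆ M.E ∧ X.ncard = 1} ×ˢ
        {Y : Set α | Y ⊆ (hUHfin.toFinset : Set α) ∧ q - 1 ≤ Y.ncard ∧ Y.ncard ≤ c - 1}).Finite :=
      (M.ground_finite.finite_subsets.subset (fun X hX => hX.1)).prod
        ((Finset.finite_toSet _).finite_subsets.subset (fun Y hY => hY.1))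
    have hinj : T₃.ncard ≤ ({X : Set α | X ⊆ M.E ∧ X.ncard = 1} ×ˢ
        {Y : Set α | Y ⊆ (hUHfin.toFinset : Set α) ∧ q - 1 ≤ Y.ncard ∧ Y.ncard ≤ c - 1}).ncard := by
      refine Set.ncard_le_ncard_of_injOn (fun B => (B \ UH M q ν₁, B ∩ UH M q ν₁)) ?_ ?_ hfin
      · intro B hB
        obtain ⟨hBE, hBU, ⟨x, hxE, hBx⟩, hqB, hBc⟩ := hB
        have hBfin : B.Finite := M.ground_finite.subset hBE
        have hsing : B \ UH M q ν₁ ⊆ {x} := by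
          intro y hy
          rcases hBx hy.1 with h | h
          · exact h
          · exact absurd h hy.2
        have hne : (B \ UH M q ν₁).Nonempty := by
          rw [Set.nonempty_iff_ne_empty]
          intro h0
          exact hBU (Set.sdiff_eq_empty.1 h0)
        have hX1 : (B \ UH M q ν₁).ncard = 1 := by
          have h1 : (B \ UH M q ν₁).ncard ≤ 1 :=
            (Set.ncard_le_ncard hsing (Set.finite_singleton x)).trans (by simp)
          have h2 : 1 ≤ (B \ UH M q ν₁).ncard := by
            rw [Nat.one_le_iff_ne_zero, Ne, Set.ncard_eq_zero (hBfin.subset Set.sdiff_subset)]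
            exact Set.nonempty_iff_ne_empty.1 hne
          omega
        have hsplit : B.ncard = (B \ UH M q ν₁).ncard + (B ∩ UH M q ν₁).ncard := by
          have hdis : Disjoint (B \ UH M q ν₁) (B ∩ UH M q ν₁) :=
            Set.disjoint_left.2 (fun y hy hy' => hy.2 hy'.2)
          rw [← Set.ncard_union_eq hdis (hBfin.subset Set.sdiff_subset)
            (hBfin.subset Set.inter_subset_left), Set.sdiff_union_inter]
        rw [Set.mem_prod]
        refine ⟨⟨fun y hy => hBE hy.1, hX1⟩, ⟨?_, ?_, ?_⟩⟩
        · rw [Set.Finite.coe_toFinset]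
          exact Set.inter_subset_right
        · show q - 1 ≤ (B ∩ UH M q ν₁).ncard
          omega
        · show (B ∩ UH M q ν₁).ncard ≤ c - 1
          omega
      · intro B _ B' _ h
        simp only [Prod.mk.injEq] at h
        rw [← Set.sdiff_union_inter B (UH M q ν₁), ← Set.sdiff_union_inter B' (UH M q ν₁), h.1, h.2]
    rw [Set.ncard_prod] at hinj
    have h1 : {X : Set α | X ⊆ M.E ∧ X.ncard = 1}.ncard ≤ M.E.ncard := by
      have := ncard_subsets_ncard_eq (groundF M) 1
      rw [coe_groundF, card_groundF, Nat.choose_one_right] at this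
      exact this.le
    have h2 : {Y : Set α | Y ⊆ (hUHfin.toFinset : Set α) ∧ q - 1 ≤ Y.ncard ∧ Y.ncard ≤ c - 1}.ncard ≤
        ∑ j ∈ Finset.Icc (q - 1) (c - 1), (UH M q ν₁).ncard.choose j := by
      have := ncard_subsets_ncard_window hUHfin.toFinset (q - 1) (c - 1)
      rwa [← Set.ncard_eq_toFinset_card _ hUHfin] at this
    calc T₃.ncard ≤ _ := hinj
      _ ≤ M.E.ncard * ∑ j ∈ Finset.Icc (q - 1) (c - 1), (UH M q ν₁).ncard.choose j :=
          Nat.mul_le_mul h1 h2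
  calc _ ≤ (T₁ ∪ (T₂ ∪ T₃)).ncard := ncard_le_ncard hsub (hT₁fin.union (hT₂fin.union hT₃fin))
    _ ≤ T₁.ncard + (T₂ ∪ T₃).ncard := ncard_union_le _ _
    _ ≤ T₁.ncard + (T₂.ncard + T₃.ncard) := by
        gcongr
        exact ncard_union_le _ _
    _ ≤ _ := Nat.add_le_add hT₁ (Nat.add_le_add hT₂ hT₃)

end Matroid

end PercRepro
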